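import Mathlib
import Summits.Ventures.HodgeRepro.PeriodCloserC7Identification
import Summits.Ventures.HodgeRepro.PeriodCloserC7LineClassesArch

/-!
# PeriodCloserC7Capstone — the closer C7 with every gen 2 / gen 3 refinement in one signature

Blind re-derivation cell `pub-hodge-repro`, seat night-2 (gen 3).  Target tree path
`lean/Summits/Ventures/HodgeRepro/PeriodCloserC7Capstone.lean`.  Composes gen 2's components of the ONE unprinted
identification (`PeriodCloserC7Identification.lean`), the finite-place line-class interface with (E2) discharged by
reciprocity (`PeriodCloserC7LineClassesFin.lean`) and the archimedean clause discharged from the signature identity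
(`PeriodCloserC7LineClassesArch.lean`).

`ChainHypothesesCapstone C A` is gen 0's `ChainHypothesesAdm I` with: `ident` → the component interfaces and bundles
(D0)–(D4) / (S1)–(S3); `discharge : LocalDischarge I` → the three clauses (E1), (E3), (E5) on admissible data plus the
SIGNATURE IDENTITY at the real places (`ArchInterface.SignatureIdentity` — N1 at the real places, ROUTE-B §9.3 / §9.8),
the finite-place (E2) clause being the theorem `E2_withClasses_of_R1` over the line-class interface `C`.  The closer is
`S4face_capstone (C) (A) (H : ChainHypothesesCapstone C A) : I.S4face`.

Hypotheses by class, at this point of the chain: PRINTED — Borade et al. 2025 Thm 1.4, BHTY 2025 Thm 1.1 / Lemma 4.11,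
Tate's product formula, (9.1c) from Kudla (inside `A`), the printed shapes of (D0)–(D4), (S1)–(S3); ROUTE-DERIVED —
Lemma Π over its printed inputs, the witness, the §9.10 flip on admissible data, (E1) / (E3) / (E5) on admissible data,
the admissible family, the free choice of the finite classes (Liu Prop 4.13 / Cor 4.20), the signature identity, the
route-derived components (D1), (S3a); STRUCTURAL — (S2), the definitional links; UNPRINTED — the normalisation matches of
the components (gen 2's residual list).  No statement of ROUTE.md (S4, S4 on the faces, (P)) is closed.  Nothing here
says anything about the status of the Hodge conjecture for CM abelian varieties, which is NOT proved.
-/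

set_option autoImplicit false

noncomputable section

namespace Summit.Ventures.HodgeRepro.PeriodCloser

open NumberField

variable {L : Type} [Field L] [NumberField L] [IsCMField L]

/-- **The hypotheses of the chain, fully refined**: components of the identification, the local discharge reduced to
(E1), (E3), (E5) and the signature identity at the real places, over a finite-place line-class interface `C` and an
archimedean interface `A`. -/
structure ChainHypothesesCapstone {I : C7Face L} {D : NormResidueData I.Place} (C : LineClassInterfaceFin I D)
    (A : ArchInterface I C.Real) where
  /-- the doubling interface -/
  Dbl : DoublingInterface I
  /-- the components (D0)–(D4) of the doubling form -/
  hD : DoublingComponents I Dbl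
  /-- the spectral interface -/
  Sp : SpectralInterface I
  /-- the components (S1)–(S3) of the seesaw form -/
  hS : SeesawComponents I Sp
  /-- Lemma Π -/
  lemmaPi : LemmaPi I
  /-- the witness `Y = f(X)` -/
  witness : PeriodWitness I
  /-- Borade et al. 2025 Thm 1.4 -/
  tp1 : Borade2025_Thm1_4 I
  /-- BHTY 2025 Thm 1.1 -/
  bhty : BHTY2025_Thm1_1 I
  /-- BHTY 2025 Lemma 4.11, split case -/
  bhtySplit : BHTY2025_Lemma4_11_split I
  /-- `Ξ_𝔭` infinite; split ⟹ unramified -/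
  xi : XiInfinite I
  /-- Tate's product formula -/
  productFormula : ProductFormula I
  /-- the sign flip of ROUTE-B §9.10, on admissible data -/
  flipAdm : FlipRootNumberAdm I
  /-- (E1) on admissible data -/
  e1 : ∀ d : I.Datum, I.Admissible d → I.E1 d
  /-- (E3) on admissible data -/
  e3 : ∀ d : I.Datum, I.Admissible d → I.E3 d
  /-- (E5) on admissible data -/
  e5 : ∀ d : I.Datum, I.Admissible d → I.E5 d
  /-- the signature identity at the real places on admissible data (N1 at the real places) -/
  signature : A.SignatureIdentity
  /-- the admissible family -/
  family : AdmissibleFamily I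

/-- The capstone bundle gives the finite-place bundle of `PeriodCloserC7LineClassesFin.lean`. -/
theorem ChainHypothesesCapstone.toFin {I : C7Face L} {D : NormResidueData I.Place}
    (C : LineClassInterfaceFin I D) (A : ArchInterface I C.Real) (H : ChainHypothesesCapstone C A) :
    ChainHypothesesFin C :=
  ⟨identification_of_components I H.Dbl H.Sp H.hD H.hS, H.lemmaPi, H.witness, H.tp1, H.bhty, H.bhtySplit, H.xi,
    H.productFormula, H.flipAdm, LocalDischargeFin.ofSignature A H.signature H.e1 H.e3 H.e5, H.family⟩

/-- **THE CLOSER C7, CAPSTONE FORM**: S4 for the face from the components of the identification, the printed theorems,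
the route-derived steps (Lemma Π, the witness, the flip, (E1) / (E3) / (E5), the admissible family, the free choice of
the finite line classes, the signature identity at the real places). -/
theorem S4face_capstone {I : C7Face L} {D : NormResidueData I.Place} (C : LineClassInterfaceFin I D)
    (A : ArchInterface I C.Real) (H : ChainHypothesesCapstone C A) : I.S4face :=
  S4face_of_chain_fin C (ChainHypothesesCapstone.toFin C A H)

end Summit.Ventures.HodgeRepro.PeriodCloser

end
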